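import Mathlib
import HarnessLib
import Literature.Combinatorics.Additive.StepBeyondKempermanTransformCritical
import Literature.Combinatorics.Additive.StepBeyondKempermanClaimsNineTen
import Literature.Combinatorics.Additive.StepBeyondKempermanTypeEightDistance
import Literature.Combinatorics.Additive.NearlyQuasiPeriodicSummands

/-!
# Grynkiewicz 2009, §6 CASE I, Subcase 2 (`|B(e)| ≥ 3`): the induction step for `(A(e), B(e))`

[cite: Grynkiewicz2009, §6 Subcase 2 (proof of Thm 4.1, p. 31)] [tag: critical-pair] [tag: inverse-theorem]

Topic `Literature/Combinatorics/Additive`.  Cell `mm-stpp` (D-0046), seat `mm-stpp-lit` (gen 25); the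
port of D. J. Grynkiewicz, *A step beyond Kemperman's structure theorem*, Mathematika **55** (2009)
67–114 continued.  §6, CASE I, Subcase 2 (print p. 31; overlines as in arXiv:0710.1041v2 «Case 2»):

«Subcase 2: `|B(e)| ≥ 3`.  Suppose `|A(e) + B(e)| = |A(e)| + |B(e)| − 1` … [¶1] … So we can assume
instead that `A(e) + B(e) = A + B`.  Suppose `(A(e), B(e))` is extendible … [¶2] … So we can assume
`(A(e), B(e))` is non-extendible.  Thus Lemma 5.4 … implies that `A(e)` and `B(e)` are both
non-quasi-periodic, generating subsets, whence the theorem holds for `A(e)` and `B(e)` by induction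
hypothesis (since `|B(e)| < |B| ≤ |A|` and `|A| + |B| = |A(e)| + |B(e)|`).  Hence in view of
Corollary 4.3—which we can apply to `(A(e), B(e))` in view of `|A(e)| ≥ |B(e)| ≥ 3`, and Claims 9 and
10—it follows that `d⊆(\overline{A + B}, QP ∪ AP) ≤ 1` (recall `A(e) + B(e) = A + B`), a contradiction
(to (49) or (51)).»

¶1 and ¶2 are `false_of_critical_below_vadd_add` / `eTransform_card_add_eq_and_isNonExtendible`
(`StepBeyondKempermanTransformCritical.lean`).  THIS FILE is ¶3: the conclusion of Theorem 4.1 for the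
(translated, non-extendible) pair `(X, Y) = (A(e), B(e))` contradicts (49) `d⊆(\overline{X + Y}, QP) ≥ 2`
and (51) `d⊆(\overline{X + Y}, QAP_d) ≥ 2` together with `|\overline{X + Y}| ≥ 4` (Claim 10).

FORMALIZATION — HOW COROLLARY 4.3 IS AVOIDED.  The print invokes Corollary 4.3, an «immediate»
consequence of Theorem 4.1 and of Corollary 4.2 (A)–(C) (two and a half pages of KST analysis relying on
the canonical «Kemperman decompositions» of [Grynkiewicz 2005]).  The application only needs the
clause `d⊆(\overline{X + Y}, 𝒮) ≤ 1` of Corollary 4.3, and for the pair at hand it follows from results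
already in the tree:
* decomposition branch — `H = G` (`IsGrynkiewiczDecomp.eq_top_of_not_isQuasiPeriodic`), types (V),
  (VI), (VII) excluded by `|X| ≥ 4`, `|Y| ≥ 3`, `|\overline{X + Y}| ≥ 4`, and type (VIII) gives
  `d⊆(X, QP) ≤ 1` (`IsTypeVIII.subsetDist_isQuasiPeriodic_le_one_left`, print p. 28 «type (VIII)
  would imply `d⊆(A, QP) = 1`»), whence LEMMA 5.7 (`subsetDist_eq_one_and_seventeen_of_subsetDist_eq_one`)
  yields `d⊆(\overline{X + Y}, QP) = 1`, contradicting (49);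
* (17) branch — if `X ∪ {α}` (or `Y ∪ {β}`) is quasi-periodic then again `d⊆(X, QP) = 1` (resp.
  `d⊆(Y, QP) = 1`) and Lemma 5.7 contradicts (49); otherwise both periodic parts of the Kemperman
  decomposition of the critical pair `(X ∪ {α}, Y ∪ {β})` (Corollary 4.2, first assertion =
  `addStab_insert_add_insert_eq`, then KST) are empty, so the pair is elementary: type (I) contradicts
  the sizes, types (III)/(IV) give `|\overline{X + Y}| ≤ 2`, and type (II) — two progressions whose sum
  misses `X + Y` in exactly one element `γ` with exactly two representations («`γ` must have exactly
  two distinct representations `α + β′` and `α′ + β`», Cor 4.2 proof, p. 11), hence `γ` is the second or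
  the penultimate term — puts `\overline{X + Y}` inside a progression with difference `d` up to one
  hole, contradicting (49)/(51) (`false_of_subset_apFinset`).  This is exactly the content of
  Corollary 4.3 for `\overline{X + Y}` in the cases (A) (type (II), `𝒮 = AP_d`) and (C) (`α ∈ A′₁`,
  `𝒮 = QP_H`) that can occur here.

MAIN RESULTS (0 definitions, 0 named facts; everything PROVED).
* `Grynkiewicz2009.sc2_false_of_isAP` — the type (II) computation: `\overline{X + Y}` lies in a
  progression of difference `d` up to one hole.
* **`Grynkiewicz2009.subcaseTwo_false_of_conclusion`** — Subcase 2 ¶3: for `0 ∈ X ∩ Y`, `|X| ≥ 4`,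
  `|Y| ≥ 3`, `|X + Y| = |X| + |Y|`, `d⊆(X + Y, 𝒫) ≥ 3`, `(X, Y)` non-extendible, `X`, `Y` generating and
  not quasi-periodic, `|\overline{X + Y}| ≥ 4`, (49), (51) for `\overline{X + Y}`: the conclusion of
  Theorem 4.1 for `(X, Y)` is contradictory.

## References
* D. J. Grynkiewicz, *A step beyond Kemperman's structure theorem*, Mathematika 55 (2009) 67–114,
  doi:10.1112/S0025579300000966, §6 Subcase 2 (p. 31), Cor 4.2 (pp. 11–13), Cor 4.3 (p. 14)
  [cite: Grynkiewicz2009, Thm 4.1 (proof, Subcase 2)] — held `paper:doi-10-1112-s0025579300000966`,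
  p0011–p0014, p0031 read 2026-08-29; arXiv:0710.1041v2 «Case 2» (held `paper:arxiv-0710.1041`, p0026).
-/

namespace Literature.Combinatorics.Additive

open Finset
open scoped Pointwise

universe u

variable {G : Type u} [AddCommGroup G] [DecidableEq G]

namespace Grynkiewicz2009

/-! ### Type (II): the complement of the sumset is a progression up to one hole -/

/-- **The type (II) case of the extended pair** (Cor 4.2 (A) ⟹ Cor 4.3 for `\overline{A + B}` with
`𝒮 = AP_d`).  Let `X ∪ {α} = {x₀, x₀ + d, …}` (`p ≥ 3` terms) and `Y ∪ {β} = {y₀, y₀ + d, …}` (`q ≥ 3`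
terms) be progressions with `⟨d⟩ = G` finite and the order of `d` at least `p + q − 1`, `α ∉ X`,
`β ∉ Y`, with `(X ∪ {α}) + (Y ∪ {β}) = (X + Y) ∪ {γ}`, `γ ∉ X + Y`, and `γ ∈ X + (Y ∪ {β})`,
`γ ∈ (X ∪ {α}) + Y` (non-extendibility).  Then every representation of `γ = x₀ + y₀ + s d` uses `α` or
`β`, and two of them avoid `α`, resp. `β`; so `s = 1` or `s = p + q − 3` («`γ` must have exactly two
distinct representations», print p. 11, and «both `α` and `β` must be the second term», p. 12), and
`\overline{X + Y} = \overline{(X ∪ {α}) + (Y ∪ {β})} ∪ {γ}` lies in a progression with difference `d`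
missing at most one of its terms — contradicting `d⊆(\overline{X + Y}, QP) ≥ 2` and
`d⊆(\overline{X + Y}, QAP_e) ≥ 2` for all `e ≠ 0` (`false_of_subset_apFinset`).
[cite: Grynkiewicz2009, Cor 4.2 (A) (pp. 11–12) and §6 Subcase 2 (p. 31)] -/
theorem sc2_false_of_isAP [Fintype G] {X Y : Finset G} {α β γ x₀ y₀ d : G} {p q : ℕ}
    (hp : 3 ≤ p) (hq : 3 ≤ q)
    (hX' : insert α X = apFinset x₀ d p) (hY' : insert β Y = apFinset y₀ d q)
    (hα : α ∉ X) (hβ : β ∉ Y)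
    (hord : p + q - 1 ≤ addOrderOf d) (htop : ∀ z : G, z ∈ AddSubgroup.zmultiples d)
    (hcrit : #(insert α X + insert β Y) = p + q - 1)
    (hγ : γ ∉ X + Y) (hsum : insert α X + insert β Y = insert γ (X + Y))
    (hγX : γ ∈ X + insert β Y) (hγY : γ ∈ insert α X + Y)
    (h49 : 2 ≤ subsetDist (X + Y)ᶜ {P | IsQuasiPeriodic P})
    (h51 : ∀ e : G, e ≠ 0 → 2 ≤ subsetDist (X + Y)ᶜ {P | IsQuasiProgression e P}) : False := by
  set M := Fintype.card G with hMdef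
  have hMd : addOrderOf d = M := by
    have := addOrderOf_eq_card_of_forall_mem_zmultiples htop
    rwa [Nat.card_eq_fintype_card] at this
  have hNM : p + q - 1 ≤ M := hMd ▸ hord
  have hd : d ≠ 0 := by
    rintro rfl
    rw [addOrderOf_zero] at hord
    omega
  set c : G := x₀ + y₀ with hcdef
  -- every element of `G` is `c + k d` with `k < M`
  have hidx : ∀ z : G, ∃ k, k < M ∧ z = c + k • d := by
    intro z
    have hz := htop (z - c)
    rw [mem_zmultiples_iff_mem_range_addOrderOf, mem_image] at hz
    obtain ⟨k, hk, hkz⟩ := hz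
    rw [mem_range, hMd] at hk
    exact ⟨k, hk, by rw [hkz, add_sub_cancel]⟩
  have hinj : ∀ {k₁ k₂ : ℕ}, k₁ < M → k₂ < M → k₁ • d = k₂ • d → k₁ = k₂ := by
    intro k₁ k₂ h₁ h₂ h
    have := nsmul_injOn_Iio_addOrderOf (x := d) (by rw [Set.mem_Iio, hMd]; exact h₁)
      (by rw [Set.mem_Iio, hMd]; exact h₂) h
    exact this
  -- the sumset of the two progressions
  have hXY' : insert α X + insert β Y = apFinset c d (p + q - 1) := by
    refine eq_of_subset_of_card_le ?_ (by rw [hcrit]; exact card_apFinset_le _ _ _)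
    rw [hX', hY']
    exact apFinset_add_apFinset_subset x₀ y₀ d p q
  -- the indices of `γ`, `α`, `β`
  obtain ⟨s, hs, hγs⟩ : ∃ s, s < p + q - 1 ∧ c + s • d = γ := by
    have : γ ∈ apFinset c d (p + q - 1) := by rw [← hXY', hsum]; exact mem_insert_self _ _
    exact mem_apFinset.1 this
  obtain ⟨iα, hiα, hαe⟩ : ∃ i, i < p ∧ x₀ + i • d = α :=
    mem_apFinset.1 (by rw [← hX']; exact mem_insert_self _ _)
  obtain ⟨jβ, hjβ, hβe⟩ : ∃ j, j < q ∧ y₀ + j • d = β :=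
    mem_apFinset.1 (by rw [← hY']; exact mem_insert_self _ _)
  -- every representation of `γ` uses `α` or `β`
  have hrep : ∀ i, i < p → s - i < q → i ≤ s → i = iα ∨ s - i = jβ := by
    intro i hi hj his
    have hx : x₀ + i • d ∈ insert α X := by rw [hX']; exact mem_apFinset.2 ⟨i, hi, rfl⟩
    have hy : y₀ + (s - i) • d ∈ insert β Y := by rw [hY']; exact mem_apFinset.2 ⟨s - i, hj, rfl⟩
    have hsum' : (x₀ + i • d) + (y₀ + (s - i) • d) = γ := by
      rw [← hγs, hcdef]
      conv_rhs => rw [← Nat.add_sub_cancel' his, add_nsmul]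
      abel
    by_contra hnot
    push Not at hnot
    apply hγ
    rw [← hsum']
    refine add_mem_add ?_ ?_
    · rcases mem_insert.1 hx with h | h
      · exact absurd (hinj (by omega) (by omega) (add_left_cancel (h.trans hαe.symm))) hnot.1
      · exact h
    · rcases mem_insert.1 hy with h | h
      · exact absurd (hinj (by omega) (by omega) (add_left_cancel (h.trans hβe.symm))) hnot.2
      · exact h
  -- the index arithmetic of a representation
  have hpos : ∀ {i j : ℕ}, i < p → j < q → (x₀ + i • d) + (y₀ + j • d) = γ → i + j = s := by
    intro i j hi hj h
    apply hinj (by omega) (by omega)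
    have e1 : (x₀ + i • d) + (y₀ + j • d) = c + (i + j) • d := by rw [hcdef, add_nsmul]; abel
    rw [e1, ← hγs] at h
    exact add_left_cancel h
  -- a representation avoiding `α` (from `γ ∈ X + (Y ∪ {β})`) and one avoiding `β`
  obtain ⟨i₁, hi₁p, hi₁s, hi₁q, hi₁α⟩ : ∃ i₁, i₁ < p ∧ i₁ ≤ s ∧ s - i₁ < q ∧ i₁ ≠ iα := by
    obtain ⟨x, hx, y, hy, hxy⟩ := mem_add.1 hγX
    have hx' : x ∈ apFinset x₀ d p := by rw [← hX']; exact mem_insert_of_mem hx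
    have hy' : y ∈ apFinset y₀ d q := by rw [← hY']; exact hy
    obtain ⟨i, hi, rfl⟩ := mem_apFinset.1 hx'
    obtain ⟨j, hj, rfl⟩ := mem_apFinset.1 hy'
    have hijs := hpos hi hj hxy
    refine ⟨i, hi, by omega, by omega, fun h => hα ?_⟩
    rw [← hαe, ← h]; exact hx
  obtain ⟨i₂, hi₂p, hi₂s, hi₂q, hi₂β⟩ : ∃ i₂, i₂ < p ∧ i₂ ≤ s ∧ s - i₂ < q ∧ s - i₂ ≠ jβ := by
    obtain ⟨x, hx, y, hy, hxy⟩ := mem_add.1 hγY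
    have hx' : x ∈ apFinset x₀ d p := by rw [← hX']; exact hx
    have hy' : y ∈ apFinset y₀ d q := by rw [← hY']; exact mem_insert_of_mem hy
    obtain ⟨i, hi, rfl⟩ := mem_apFinset.1 hx'
    obtain ⟨j, hj, rfl⟩ := mem_apFinset.1 hy'
    have hijs := hpos hi hj hxy
    refine ⟨i, hi, by omega, by omega, fun h => hβ ?_⟩
    have hj' : j = jβ := by omega
    rw [← hβe, ← hj']; exact hy
  have h1 := hrep i₁ hi₁p hi₁q hi₁s
  have h2 := hrep i₂ hi₂p hi₂q hi₂s
  -- hence `s = 1` or `s = p + q − 3`: three consecutive admissible indices would be too many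
  have hs2 : s = 1 ∨ s = p + q - 3 := by
    by_contra hsn
    push Not at hsn
    by_cases hsmall : 2 ≤ s ∧ s ≤ p + q - 4
    · set lo := s + 1 - q with hlo
      have hl0 := hrep lo (by omega) (by omega) (by omega)
      have hl1 := hrep (lo + 1) (by omega) (by omega) (by omega)
      have hl2 := hrep (lo + 2) (by omega) (by omega) (by omega)
      omega
    · omega
  -- the complement of `X + Y`
  set Z : Finset G := (X + Y)ᶜ with hZdef
  have hcZ : #Z = M - (p + q - 2) := by
    have h1 : #(insert γ (X + Y)) = p + q - 1 := by rw [← hsum, hcrit]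
    rw [card_insert_of_notMem hγ] at h1
    rw [hZdef, card_compl]
    omega
  have hZmem : ∀ z ∈ Z, z = γ ∨ ∃ k, p + q - 1 ≤ k ∧ k < M ∧ z = c + k • d := by
    intro z hz
    rw [hZdef, mem_compl] at hz
    by_cases hzγ : z = γ
    · exact Or.inl hzγ
    right
    obtain ⟨k, hk, rfl⟩ := hidx z
    refine ⟨k, ?_, hk, rfl⟩
    by_contra hlt
    push Not at hlt
    have : c + k • d ∈ insert γ (X + Y) := by rw [← hsum, hXY']; exact mem_apFinset.2 ⟨k, hlt, rfl⟩
    rw [mem_insert] at this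
    rcases this with h | h
    · exact hzγ h
    · exact hz h
  have hMd0 : M • d = 0 := by rw [← hMd]; exact addOrderOf_nsmul_eq_zero d
  rcases hs2 with hs1 | hsN
  · -- `γ` is the second term: extend the complement progression past its end
    set T : Finset G := apFinset (c + (p + q - 1) • d) d (M - (p + q - 1) + 2) with hTdef
    have hZT : Z ⊆ T := by
      intro z hz
      rcases hZmem z hz with rfl | ⟨k, hk1, hk2, rfl⟩
      · rw [hTdef, mem_apFinset]
        refine ⟨M - (p + q - 1) + 1, by omega, ?_⟩
        rw [← hγs, hs1, add_assoc, ← add_nsmul]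
        have e : (p + q - 1 + (M - (p + q - 1) + 1)) = M + 1 := by omega
        rw [e, add_nsmul, hMd0, zero_add]
      · rw [hTdef, mem_apFinset]
        refine ⟨k - (p + q - 1), by omega, ?_⟩
        rw [add_assoc, ← add_nsmul]
        congr 2; omega
    have hT1 : #(T \ Z) ≤ 1 := by
      rw [card_sdiff_of_subset hZT, hcZ]
      have hTle : #T ≤ M - (p + q - 1) + 2 := card_apFinset_le _ _ _
      omega
    exact false_of_subset_apFinset hd (by omega) hZT hT1 h49 h51
  · -- `γ` is the penultimate term: extend the complement progression before its start
    set T : Finset G := apFinset (c + (p + q - 3) • d) d (M - (p + q - 1) + 2) with hTdef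
    have hZT : Z ⊆ T := by
      intro z hz
      rcases hZmem z hz with rfl | ⟨k, hk1, hk2, rfl⟩
      · rw [hTdef, mem_apFinset]
        exact ⟨0, by omega, by rw [zero_nsmul, add_zero, ← hγs, hsN]⟩
      · rw [hTdef, mem_apFinset]
        refine ⟨k - (p + q - 3), by omega, ?_⟩
        rw [add_assoc, ← add_nsmul]
        congr 2; omega
    have hT1 : #(T \ Z) ≤ 1 := by
      rw [card_sdiff_of_subset hZT, hcZ]
      have hTle : #T ≤ M - (p + q - 1) + 2 := card_apFinset_le _ _ _
      omega
    exact false_of_subset_apFinset hd (by omega) hZT hT1 h49 h51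

/-! ### Subcase 2, third paragraph -/

/-- **§6 Subcase 2 ¶3** (print p. 31): «… whence the theorem holds for `A(e)` and `B(e)` by induction
hypothesis … it follows that `d⊆(\overline{A + B}, QP ∪ AP) ≤ 1` (recall `A(e) + B(e) = A + B`), a
contradiction (to (49) or (51))».  Stated for the translated pair `(X, Y) = (A(e), B(e))` with
`0 ∈ X ∩ Y`: if `|X| ≥ 4`, `|Y| ≥ 3`, `|X + Y| = |X| + |Y|`, `d⊆(X + Y, 𝒫) ≥ 3` (Claim 5 for
`A + B = X + Y`), `(X, Y)` non-extendible (¶2), `X` and `Y` generating and not quasi-periodic (Lemma 5.4),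
`|\overline{X + Y}| ≥ 4` (Claim 10), `d⊆(\overline{X + Y}, QP) ≥ 2` (49) and
`d⊆(\overline{X + Y}, QAP_e) ≥ 2` for all `e ≠ 0` (51), then the conclusion of Theorem 4.1 (first
part) for `(X, Y)` — (17), or a decomposition of types (V)–(VIII) — is impossible.  (Route: see the
module docstring — Lemma 5.7 replaces Corollary 4.3.)
[cite: Grynkiewicz2009, §6 Subcase 2 (proof of Thm 4.1, p. 31); Cor 4.3 (p. 14)] -/
theorem subcaseTwo_false_of_conclusion [Fintype G] {X Y : Finset G}
    (h0X : (0 : G) ∈ X) (h0Y : (0 : G) ∈ Y) (hX4 : 4 ≤ #X) (hY3 : 3 ≤ #Y)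
    (hXY : #(X + Y) = #X + #Y)
    (hP3 : ∀ P : Finset G, X + Y ⊆ P → P.addStab ≠ {0} → 3 ≤ #(P \ (X + Y)))
    (hneX : IsNonExtendible X Y) (hneY : IsNonExtendible Y X)
    (hgenX : AddSubgroup.closure (X : Set G) = ⊤) (hXqp : ¬ IsQuasiPeriodic X)
    (hgenY : AddSubgroup.closure (Y : Set G) = ⊤) (hYqp : ¬ IsQuasiPeriodic Y)
    (hC4 : 4 ≤ #(X + Y)ᶜ)
    (h49 : 2 ≤ subsetDist (X + Y)ᶜ {P | IsQuasiPeriodic P})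
    (h51 : ∀ e : G, e ≠ 0 → 2 ≤ subsetDist (X + Y)ᶜ {P | IsQuasiProgression e P})
    (hconcl : (∃ α β : G, #(insert α X + insert β Y) + 1 = #(insert α X) + #(insert β Y)) ∨
      ∃ (K : AddSubgroup G) (X₁ X₀ Y₁ Y₀ : Finset G), IsGrynkiewiczDecomp K X Y X₁ X₀ Y₁ Y₀) :
    False := by
  classical
  have hMX : #X ≤ Fintype.card G := card_le_univ X
  haveI : Nontrivial G := by
    rw [← Fintype.one_lt_card_iff_nontrivial]; omega
  -- Lemma 5.7 turns `d⊆(X, QP) = 1` (or `d⊆(Y, QP) = 1`) into `d⊆(\overline{X + Y}, QP) = 1`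
  have hmemC : (X + Y)ᶜ ∈ ({X, Y, X + Y, Xᶜ, Yᶜ, (X + Y)ᶜ} : Finset (Finset G)) := by simp
  have keyX : subsetDist X {P | IsQuasiPeriodic P} = 1 → False := fun hd => by
    have h57 := (subsetDist_eq_one_and_seventeen_of_subsetDist_eq_one (by omega) hY3 (Or.inl hX4)
      h0X h0Y hXY hP3 hneX hneY hgenX hd).1 _ hmemC
    rw [h57] at h49
    exact absurd h49 (by norm_num)
  have keyY : subsetDist Y {P | IsQuasiPeriodic P} = 1 → False := fun hd => by
    have hYX : #(Y + X) = #Y + #X := by rw [add_comm, hXY, add_comm]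
    have hP3' : ∀ P : Finset G, Y + X ⊆ P → P.addStab ≠ {0} → 3 ≤ #(P \ (Y + X)) := by
      rw [add_comm Y X]; exact hP3
    have hmemC' : (X + Y)ᶜ ∈ ({Y, X, Y + X, Yᶜ, Xᶜ, (Y + X)ᶜ} : Finset (Finset G)) := by
      rw [add_comm Y X]; simp
    have h57 := (subsetDist_eq_one_and_seventeen_of_subsetDist_eq_one hY3 (by omega) (Or.inr hX4)
      h0Y h0X hYX hP3' hneY hneX hgenY hd).1 _ hmemC'
    rw [h57] at h49
    exact absurd h49 (by norm_num)
  have hne0 : ∀ {Z : Finset G}, ¬ IsQuasiPeriodic Z → subsetDist Z {P | IsQuasiPeriodic P} ≤ 1 →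
      subsetDist Z {P | IsQuasiPeriodic P} = 1 := by
    intro Z hZ hle
    refine le_antisymm hle ?_
    rw [Order.one_le_iff_ne_zero]
    exact fun h0 => hZ (subsetDist_eq_zero_iff.1 h0)
  rcases hconcl with ⟨α, β, h17⟩ | ⟨K, X₁, X₀, Y₁, Y₀, hD⟩
  · /- the (17) branch -/
    obtain ⟨hα, hβ⟩ := notMem_of_seventeen hXY hneX hneY h17
    by_cases hX'qp : IsQuasiPeriodic (insert α X)
    · exact keyX (subsetDist_eq_one_iff.2 ⟨hXqp, α, hα, hX'qp⟩)
    by_cases hY'qp : IsQuasiPeriodic (insert β Y)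
    · exact keyY (subsetDist_eq_one_iff.2 ⟨hYqp, β, hβ, hY'qp⟩)
    -- KST for the extended pair: both periodic parts are empty, so the pair is elementary
    obtain ⟨γ, hγ, hsum⟩ := exists_insert_eq_of_seventeen hXY hα hβ h17
    have hap := addStab_insert_add_insert_eq hXY hneX hneY h17
    have hX'ne : (insert α X).Nonempty := insert_nonempty α X
    have hY'ne : (insert β Y).Nonempty := insert_nonempty β Y
    have hnp : ¬ IsPeriodic (insert α X + insert β Y) := fun h =>
      (isPeriodic_iff_addStab_ne (hX'ne.add hY'ne)).1 h hap
    obtain ⟨L, X₁, X₀, Y₁, Y₀, hK⟩ :=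
      exists_isKempermanDecompI_of_not_isPeriodic' hX'ne hY'ne h17.le hnp
    obtain ⟨-, hX₀⟩ := hK.decomp_left.left_eq_empty_of_not_isQuasiPeriodic hX'qp
    obtain ⟨-, hY₀⟩ := hK.decomp_right.left_eq_empty_of_not_isQuasiPeriodic hY'qp
    have hE := hK.elementary
    rw [hX₀, hY₀] at hE
    have hcX' : #(insert α X) = #X + 1 := card_insert_of_notMem hα
    have hcY' : #(insert β Y) = #Y + 1 := card_insert_of_notMem hβ
    have hcXY : #(insert α X + insert β Y) = #(X + Y) + 1 := by rw [hsum, card_insert_of_notMem hγ]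
    have hcC : #(X + Y)ᶜ = Fintype.card G - #(X + Y) := card_compl _
    have hle : #(insert α X + insert β Y) ≤ Fintype.card G := card_le_univ _
    -- the two representations of `γ` avoiding `α`, resp. `β` (non-extendibility)
    have hγX : γ ∈ X + insert β Y := by
      by_contra hn
      apply hneY β hβ
      refine Subset.antisymm ?_ (add_subset_add_right (subset_insert _ _))
      intro z hz
      rw [add_comm (insert β Y) X] at hz
      rw [add_comm Y X]
      have hz' : z ∈ insert α X + insert β Y := add_subset_add_right (subset_insert α X) hz
      rw [hsum, mem_insert] at hz'
      rcases hz' with rfl | hz'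
      · exact absurd hz hn
      · exact hz'
    have hγY : γ ∈ insert α X + Y := by
      by_contra hn
      apply hneX α hα
      refine Subset.antisymm ?_ (add_subset_add_right (subset_insert _ _))
      intro z hz
      have hz' : z ∈ insert α X + insert β Y := add_subset_add_left (subset_insert β Y) hz
      rw [hsum, mem_insert] at hz'
      rcases hz' with rfl | hz'
      · exact absurd hz hn
      · exact hz'
    rcases hE with hI | hII | hIII | hIV
    · rcases hI.2.2 with h1 | h1 <;> omega
    · -- type (II)
      obtain ⟨-, -, d, hXd, hYd, hordII⟩ := hII
      obtain ⟨x₀, hX'ap⟩ := hXd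
      obtain ⟨y₀, hY'ap⟩ := hYd
      have hord : #(insert α X) + #(insert β Y) - 1 ≤ addOrderOf d := by
        rcases hordII with h0 | h
        · exact absurd h0 (addOrderOf_pos d).ne'
        · exact h
      -- `⟨d⟩ = G`: `0 ∈ X ⊆ x₀ + ⟨d⟩` and `⟨X⟩ = G`
      have htop : ∀ z : G, z ∈ AddSubgroup.zmultiples d := by
        obtain ⟨i₀, -, h0e⟩ : ∃ i, i < #(insert α X) ∧ x₀ + i • d = 0 :=
          mem_apFinset.1 (by rw [← hX'ap]; exact mem_insert_of_mem h0X)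
        have hx₀ : x₀ ∈ AddSubgroup.zmultiples d := by
          have e : x₀ = -(i₀ • d) := by rw [← sub_eq_zero, sub_neg_eq_add, h0e]
          rw [e]
          exact AddSubgroup.neg_mem _ (AddSubgroup.nsmul_mem _ (AddSubgroup.mem_zmultiples d) _)
        have hsub : (X : Set G) ⊆ AddSubgroup.zmultiples d := by
          intro x hx
          have hx' : x ∈ apFinset x₀ d #(insert α X) := by
            rw [← hX'ap]; exact mem_insert_of_mem (mem_coe.1 hx)
          obtain ⟨i, -, rfl⟩ := mem_apFinset.1 hx'
          exact AddSubgroup.add_mem _ hx₀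
            (AddSubgroup.nsmul_mem _ (AddSubgroup.mem_zmultiples d) _)
        have htop' : (⊤ : AddSubgroup G) ≤ AddSubgroup.zmultiples d := by
          rw [← hgenX]; exact (AddSubgroup.closure_le _).2 hsub
        exact fun z => htop' (AddSubgroup.mem_top z)
      exact sc2_false_of_isAP (p := #(insert α X)) (q := #(insert β Y)) (by omega) (by omega)
        hX'ap hY'ap hα hβ hord htop (by omega) hγ hsum hγX hγY h49 h51
    · -- type (III): the sumset would be a whole coset of `K = G`
      obtain ⟨K, a, b, -, -, hAK, -, hcard, -⟩ := hIII
      have hKtop : K = ⊤ :=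
        eq_top_of_coset_of_closure_eq_top h0X hgenX fun x hx => hAK x (mem_insert_of_mem hx)
      subst hKtop
      rw [AddSubgroup.card_top, Nat.card_eq_fintype_card] at hcard
      omega
    · -- type (IV): the sumset would miss exactly one element of `G`
      obtain ⟨K, a, b, g, -, -, hAK, -, -, -, -, hiff⟩ := hIV
      have hKtop : K = ⊤ :=
        eq_top_of_coset_of_closure_eq_top h0X hgenX fun x hx => hAK x (mem_insert_of_mem hx)
      subst hKtop
      have hAeq : insert α X = ((insert β Y)ᶜ).image (fun y => g - y) := by
        ext x
        rw [mem_image]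
        constructor
        · intro hx
          exact ⟨g - x, mem_compl.2 ((hiff x).1 hx).2, sub_sub_cancel g x⟩
        · rintro ⟨y, hy, rfl⟩
          exact (hiff _).2 ⟨AddSubgroup.mem_top _, by rw [sub_sub_cancel]; exact mem_compl.1 hy⟩
      have hcardA : #(insert α X) = Fintype.card G - #(insert β Y) := by
        rw [hAeq, card_image_of_injective _ sub_right_injective, card_compl]
      have := card_le_univ (insert β Y)
      omega
  · /- the decomposition branch: `H = G`, types (V)–(VIII) -/
    obtain ⟨hK, -, hX₀, -, hY₀⟩ := hD.eq_top_of_not_isQuasiPeriodic h0X hgenX hXqp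
    subst hK
    have hbot := hD.bottom
    rw [hX₀, hY₀] at hbot
    rcases hbot with hV | hVI | hVII | hVIII
    · have := hV.1
      omega
    · have := hVI.1
      omega
    · obtain ⟨K', A'', B'', -, hVI'', hdual⟩ := hVII
      have h6 : #(A'' + B'') = 6 := by rw [hVI''.card_add, hVI''.1, hVI''.2.1]
      have h6le : #(A'' + B'') ≤ Fintype.card G := card_le_univ _
      obtain ⟨a, -, c, -, -, -, -, -, hcases⟩ := hdual
      rcases hcases with ⟨g, g', hXg, -⟩ | ⟨g, g', hYg, hXiff⟩
      · have : #X = 3 := by rw [hXg, card_vadd_finset, card_neg, hVI''.1]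
        omega
      · have hK'top : K' = ⊤ := by
          refine eq_top_of_coset_of_closure_eq_top (a := g' + (a + c)) h0X hgenX fun y hy => ?_
          have := ((hXiff y).1 hy).1
          rwa [sub_sub] at this
        subst hK'top
        have hXeq2 : X = g' +ᵥ (A'' + B'')ᶜ := by
          ext z
          rw [hXiff z, mem_vadd_finset]
          constructor
          · rintro ⟨-, hz⟩
            exact ⟨z - g', mem_compl.2 hz, by rw [vadd_eq_add]; abel⟩
          · rintro ⟨y, hy, rfl⟩
            refine ⟨AddSubgroup.mem_top _, ?_⟩
            rw [vadd_eq_add, add_sub_cancel_left]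
            exact mem_compl.1 hy
        have hXc2 : #X = Fintype.card G - 6 := by rw [hXeq2, card_vadd_finset, card_compl, h6]
        have hYc : #Y = 3 := by rw [hYg, card_vadd_finset, card_neg, hVI''.2.1]
        have hcC : #(X + Y)ᶜ = Fintype.card G - #(X + Y) := card_compl _
        omega
    · exact keyX (hne0 hXqp hVIII.subsetDist_isQuasiPeriodic_le_one_left)

end Grynkiewicz2009

end Literature.Combinatorics.Additive
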